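import Mathlib
import HarnessLib
import Literature.Analysis.FluidPDE.SelfSimilar
import Literature.Analysis.FluidPDE.ClassicalSolution
import Literature.Analysis.FluidPDE.ClassicalSolutionCalculus
import Literature.Analysis.FluidPDE.Vorticity
import Literature.Analysis.FluidPDE.VectorCalculus
import Literature.Analysis.FluidPDE.VorticityCalculus
import Literature.Analysis.FluidPDE.NSBoundedMildOseenClassical
import Literature.Analysis.FluidPDE.AxisymmetricEuler
import Literature.Analysis.FluidPDE.AxisymmetricVorticityTransport
import Summits.NavierStokesRegularity.NavierStokesRegularity.Theorems.UnthreadedDoorNetFluxDefs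
import Summits.NavierStokesRegularity.NavierStokesRegularity.Theorems.UnthreadedDoorVorticityOfClass
import Summits.NavierStokesRegularity.NavierStokesRegularity.Theorems.UnthreadedDoorCellFluxZDefs
import Summits.NavierStokesRegularity.NavierStokesRegularity.Theorems.UnthreadedDoorCellFluxZonalKinematic
import Summits.NavierStokesRegularity.NavierStokesRegularity.Theorems.UnthreadedDoorCellFluxAxisFrozenStatics
import Summits.NavierStokesRegularity.NavierStokesRegularity.Theorems.UnthreadedDoorCellFluxAxisFrozenFrame

/-!
# Route `UnthreadedDoor`, crux `PoloidalLiouville` (stmt-NavierStokesRegularity-1222), WALL W1 — cell-flux Z skeleton, stub Z-1b `AxisFrozen`: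
# the canonical frame of a direction and the frame-free PER-TIME PACKAGE (`CellFluxZSkeleton.lean` v1.1 c6ae0be7f8d8; custodian ns-idea-14, critic V22)

* `exists_frame`: for `e ≠ 0`, ONE linear isometry `R` (the reflection exchanging `e/‖e‖` and `e_z`, Mathlib `Submodule.reflection_sub`) with `R e = ‖e‖ e_z`
  in which EVERY `C²`, bounded, divergence-free field with curl `⊥ x − x₀` and `⊥ e` becomes, minus its value at `x₀`, axisymmetric swirl-free (the Z-1a
  construction `axisymmetricNoSwirl_sub_apply_zero`, frame depending on `e` only);
* `isAxisymmetricNoSwirlAbout_of_sub_vertical`: adding a constant along the axis keeps axisymmetry and swirl-freeness;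
* `frame_package`: at each `t ≤ t₁` a direction `e(t) ≠ 0` with `ω(t,·) ⊥ e(t)`, `∂ₜω(t,·) ⊥ e(t)` (`frame_dynamic`), uniqueness of the zonal direction,
  `v t x₀ ∥ e(t)`, 90°-partners, and spanning — the inputs of the axis-freezing argument (`UnthreadedDoorCellFluxAxisFrozen`).

WHAT THIS IS NOT: support for one stub of Z; `PoloidalLiouville` (1222), Z, W1 and NS regularity stay OPEN.  `--supports 1222 --as helper`. [folklore]
-/

noncomputable section

-- the summit and its single sub-problem share the name (CONVENTIONS §1)
set_option linter.dupNamespace false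

open Set Function Filter Topology MeasureTheory Metric InnerProductSpace
open scoped RealInnerProductSpace InnerProductSpace

namespace Summit.NavierStokesRegularity.NavierStokesRegularity.Theorems.PoloidalLiouville.CellFlux

open Summit.NavierStokesRegularity.NavierStokesRegularity.Theorems.PoloidalLiouville.NetFlux (E3)
open Literature.Analysis Literature.Analysis.FluidPDE

/-! ### §1 Kinematic helpers: the canonical frame of a direction; vertical constants -/

/-- **The canonical frame of a direction** (the reflection exchanging `e/‖e‖` and `e_z`, Mathlib `Submodule.reflection_sub`): for every `e ≠ 0` there is a
linear isometry `R` with `R e = ‖e‖ e_z` such that EVERY `C²`, bounded, divergence-free field whose curl is orthogonal to `x − x₀` and to `e` is, minus its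
value at `x₀`, axisymmetric without swirl in the frame `(R, x₀)` — the Z-1a construction (`axisymmetricNoSwirl_sub_apply_zero`) with the frame depending
on `e` only. [folklore] -/
theorem exists_frame (x₀ : E3) {e : E3} (he : e ≠ 0) :
    ∃ R : E3 ≃ₗᵢ[ℝ] E3, R e = ‖e‖ • EuclideanSpace.single 2 (1 : ℝ) ∧
      ∀ (u : E3 → E3) (M : ℝ), ContDiff ℝ 2 u → (∀ x, ‖u x‖ ≤ M) → VectorCalculus.IsDivFree u →
        (∀ x, ⟪x - x₀, curl u x⟫ = 0) → (∀ x, ⟪e, curl u x⟫ = 0) →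
        IsAxisymmetricNoSwirlAbout R x₀ (fun y => u y - u x₀) := by
  set ez : E3 := EuclideanSpace.single (2 : Fin 3) (1 : ℝ) with hez
  set u₁ : E3 := ‖e‖⁻¹ • e with hu₁
  have hne : ‖e‖ ≠ 0 := norm_ne_zero_iff.2 he
  have hn1 : ‖u₁‖ = ‖ez‖ := by
    have h1 : ‖u₁‖ = 1 := by
      rw [hu₁, norm_smul, norm_inv, norm_norm, inv_mul_cancel₀ hne]
    have h2 : ‖ez‖ = 1 := by
      rw [hez]
      simp
    rw [h1, h2]
  set R : E3 ≃ₗᵢ[ℝ] E3 := (ℝ ∙ (u₁ - ez))ᗮ.reflection with hR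
  have hRu : R u₁ = ez := Submodule.reflection_sub hn1
  have hRs : R.symm ez = u₁ := by
    rw [← hRu]
    exact R.symm_apply_apply u₁
  refine ⟨R, ?_, fun u M hu hM hdiv hperp hzon => ?_⟩
  · have : e = ‖e‖ • u₁ := by rw [hu₁, smul_smul, mul_inv_cancel₀ hne, one_smul]
    conv_lhs => rw [this]
    rw [map_smul, hRu]
  set W : E3 → E3 := conjAxis R x₀ u with hW
  have hkey : conjAxis R x₀ (fun y => u y - u x₀) = fun y => W y - W 0 := by
    funext y
    simp [hW, conjAxis, map_sub]
  have hW2 : ContDiff ℝ 2 W := R.contDiff.comp (hu.comp ((R.symm.contDiff).add contDiff_const))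
  have hWM : ∀ y, ‖W y‖ ≤ M := fun y => by
    rw [hW, conjAxis_apply, LinearIsometryEquiv.norm_map]
    exact hM _
  have hWdiv : VectorCalculus.IsDivFree W := (hdiv.comp_add_right x₀).conj_linearIsometryEquiv R
  have hWz : ∀ y, curl W y 2 = 0 := fun y => by
    have h : ⟪curl W y, ez⟫ = 0 := by
      rw [hW, inner_curl_conjAxis_eq_zero_iff, hRs, hu₁, real_inner_smul_right, real_inner_comm, hzon, mul_zero]
    simpa [hez, EuclideanSpace.inner_single_right] using h
  have hWperp : ∀ y, ⟪y, curl W y⟫ = 0 := fun y => by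
    rw [real_inner_comm, hW, inner_curl_conjAxis_eq_zero_iff]
    have h := hperp (R.symm y + x₀)
    rwa [add_sub_cancel_right, real_inner_comm] at h
  show IsAxisymmetric (conjAxis R x₀ fun y => u y - u x₀) ∧ HasNoSwirl (conjAxis R x₀ fun y => u y - u x₀)
  rw [hkey]
  exact axisymmetricNoSwirl_sub_apply_zero hW2 hWM hWdiv hWz hWperp

/-- **Adding a constant ALONG THE AXIS preserves axisymmetry and swirl-freeness**: if `u − c₀` is axisymmetric swirl-free in the frame `(R, p)` and `R c₀`
is vertical, then so is `u`. [folklore] -/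
theorem isAxisymmetricNoSwirlAbout_of_sub_vertical {u : E3 → E3} {R : E3 ≃ₗᵢ[ℝ] E3} {p c₀ : E3} (κ : ℝ)
    (hc : R c₀ = κ • EuclideanSpace.single 2 (1 : ℝ)) (h : IsAxisymmetricNoSwirlAbout R p (fun y => u y - c₀)) :
    IsAxisymmetricNoSwirlAbout R p u := by
  obtain ⟨hax, hsw⟩ := h
  set W : E3 → E3 := conjAxis R p fun y => u y - c₀ with hW
  have hrel : conjAxis R p u = fun y => W y + κ • EuclideanSpace.single 2 (1 : ℝ) := by
    funext y
    rw [← hc]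
    simp [hW, conjAxis, map_sub]
  have hfix : ∀ θ : ℝ, rotZ θ (κ • EuclideanSpace.single 2 (1 : ℝ)) = κ • EuclideanSpace.single 2 (1 : ℝ) := by
    intro θ
    ext i
    fin_cases i <;> simp
  refine ⟨fun θ y => ?_, fun y => ?_⟩
  · rw [hrel]
    simp only
    rw [hax θ y, ← rotZL_apply, ← rotZL_apply, map_add, rotZL_apply, rotZL_apply, hfix]
  · rw [hrel]
    have h0 := hsw y
    simp only [swirl, PiLp.add_apply, PiLp.smul_apply, smul_eq_mul] at h0 ⊢
    simp
    linarith [h0]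

/-! ### §2 The per-time package -/

section Package

variable {v : ℝ → E3 → E3} {x₀ : E3} {T : ℝ → E3 → ℝ}

/-- **The frame-free per-time package** on `(-∞, t₁]` (stated as a total function of `t` for `choose`): a direction `e(t) ≠ 0` with `ω(t,·) ⊥ e(t)`,
`∂ₜω(t,·) ⊥ e(t)`, uniqueness of the zonal direction, `v t x₀ ∥ e(t)`, 90°-partners and the spanning property. [folklore] -/
theorem frame_package (hB : IsBoundedAncientMildSolution 1 v)
    (hsm : ContDiffOn ℝ (⊤ : ℕ∞) (uncurry v) (Iio 0 ×ˢ univ))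
    (hlink : ∀ t < 0, ∀ x, curl (v t) x = cross (gradient (T t) x) (x - x₀))
    (hframe : ∀ t < 0, ∃ (R : E3 ≃ₗᵢ[ℝ] E3) (c : E3), IsAxisymmetricNoSwirlAbout R x₀ (fun y => v t y - c))
    {t₁ : ℝ} (ht₁ : t₁ < 0) (hnz : ∀ t ≤ t₁, ∃ x, curl (v t) x ≠ 0) :
    ∀ t : ℝ, ∃ e : E3, t ≤ t₁ →
      e ≠ 0 ∧
      (∀ x, ⟪e, curl (v t) x⟫ = 0) ∧
      (∀ x, ⟪e, timeDerivWithin (Iio 0) (vorticity v) t x⟫ = 0) ∧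
      (∀ d : E3, (∀ x, ⟪d, curl (v t) x⟫ = 0) → ∃ μ : ℝ, d = μ • e) ∧
      (∃ κ : ℝ, v t x₀ = κ • e) ∧
      (∀ x₁, ∃ x₂, ‖curl (v t) x₂‖ = ‖curl (v t) x₁‖ ∧ ⟪curl (v t) x₁, curl (v t) x₂⟫ = 0) ∧
      (∀ (x₁ x₂ d : E3), ‖curl (v t) x₁‖ ^ 2 * ‖curl (v t) x₂‖ ^ 2 - ⟪curl (v t) x₁, curl (v t) x₂⟫ ^ 2 ≠ 0 →
        ⟪d, curl (v t) x₁⟫ = 0 → ⟪d, curl (v t) x₂⟫ = 0 → ∀ x, ⟪d, curl (v t) x⟫ = 0) := by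
  intro t
  by_cases ht : t ≤ t₁
  swap
  · exact ⟨0, fun h => absurd h ht⟩
  have ht0 : t < 0 := lt_of_le_of_lt ht ht₁
  obtain ⟨R, c, hax, hsw⟩ := hframe t ht0
  have hsm' : IsSmoothSpaceTimeOn (Iio 0) v := hsm
  have hvt : ContDiff ℝ (⊤ : ℕ∞) (v t) := hsm'.contDiff_slice ht0
  have hv1 : ContDiff ℝ 1 (v t) := hvt.of_le (by norm_cast)
  set e : E3 := R.symm (EuclideanSpace.single 2 (1 : ℝ)) with hedef
  have he : e ≠ 0 := by
    intro h0
    have : ‖e‖ = 1 := by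
      rw [hedef, LinearIsometryEquiv.norm_map]
      simp
    rw [h0, norm_zero] at this
    exact zero_ne_one this
  obtain ⟨hdyn1, hdyn2⟩ := frame_dynamic hB hsm hlink ht0 hax hsw
  obtain ⟨x₁, hx₁⟩ := hnz t ht
  have hU : ∀ d : E3, (∀ x, ⟪d, curl (v t) x⟫ = 0) → ∃ μ : ℝ, d = μ • e := fun d hd =>
    exists_smul_dir_of_forall_inner_curl hv1 hax hsw hx₁ hd
  refine ⟨e, fun _ => ⟨he, fun x => inner_dir_curl_eq_zero hv1 hax hsw x, hdyn1, hU, ?_,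
    fun x₁ => exists_orthogonal_partner hv1 hax hsw x₁, fun x₁ x₂ d hG h₁ h₂ => forall_inner_curl_of_pair hv1 hax hsw hG h₁ h₂⟩⟩
  obtain ⟨μ, hμ⟩ := hU c hdyn2
  obtain ⟨κ, hκ⟩ := exists_apply_centre_sub_eq_smul (u := v t) hax
  refine ⟨κ + μ, ?_⟩
  rw [add_smul, ← hκ, ← hμ, sub_add_cancel]

end Package

end Summit.NavierStokesRegularity.NavierStokesRegularity.Theorems.PoloidalLiouville.CellFlux

end
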